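import Mathlib
import Summits.Ventures.PercRepro2.Defs
import Summits.Ventures.PercRepro2.Independence
import Summits.Ventures.PercRepro2.Graph
import Summits.Ventures.PercRepro2.Exploration

/-!
# The events and functionals of the Kozma–Nitzan family (blind cell PercRepro2, typer-1)

Vocabulary for the typed rows of `Statements.lean` (PLAN §10.2; KN24 = Kozma–Nitzan,
arXiv:2401.12397, *A reduction of the θ(p_c) = 0 problem to a conjectured inequality*):

* `hitEvent ends v A` = `{v ↔ A}`: the open cluster of `v` meets the vertex set `A`;
* `hitSetEvent ends v A S` = `{C(v) ∩ A = S}`, `firstHitWeight p ends v A a = P(C(v) ∩ A = {a})`;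
* `connDelEvent ends W u w` = `{u ↔ w in G ∖ W}`: connection with every edge touching `W`
  closed (the graph after the cluster `W` has been explored and removed);
* `clusterInEvent ends x 𝓔` = `{C(x) ∈ 𝓔}` for a family `𝓔` of vertex sets (up-sets give the
  monotone cluster properties of KN24 §5.1);
* `greenMatrix p ends v A a a'` = `M_{a,a'} = P(v ↔ A, a ↔ a')` (KN24 §5.2) and the
  Theorem-11 coefficient system `IsT11Coeff`;
* `explorationFunctional p ends A hA v b` = `Γ(G, A, v, b)`
  `= min_{a ∈ A} P(a ↔ b) − Σ_{W ∩ A = ∅} P(C(v) = W) · min_{a ∈ A} P_{G ∖ W}(a ↔ b)`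
  (KN24 §3.2, definition of *good*; the terms with `b ∈ W` vanish automatically because `b`
  is isolated in `G ∖ W`).

Also: decidability of `touches / within / boundary` on finite graphs.
-/

namespace Summit.Ventures.PercRepro2

/-! ## Decidability of the edge sets of `Graph.lean` on finite graphs -/

section Decidable

variable {V : Type*} {E : Type*} [Fintype V] [DecidableEq V]

/-- Membership in `touches ends S` is decidable on a finite vertex type. -/
instance instDecidablePredMemTouches (ends : E → Sym2 V) (S : Set V) [DecidablePred (· ∈ S)] :
    DecidablePred (· ∈ touches ends S) := fun e =>
  decidable_of_iff (∃ x, x ∈ S ∧ ∃ y, ends e = s(x, y)) mem_touches.symm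

/-- Membership in `within ends S` is decidable on a finite vertex type. -/
instance instDecidablePredMemWithin (ends : E → Sym2 V) (S : Set V) [DecidablePred (· ∈ S)] :
    DecidablePred (· ∈ within ends S) := fun e =>
  decidable_of_iff (∃ x, x ∈ S ∧ ∃ y, y ∈ S ∧ ends e = s(x, y)) mem_within.symm

/-- Membership in `boundary ends S` is decidable on a finite vertex type. -/
instance instDecidablePredMemBoundary (ends : E → Sym2 V) (S : Set V) [DecidablePred (· ∈ S)] :
    DecidablePred (· ∈ boundary ends S) := fun e =>
  decidable_of_iff (∃ x, x ∈ S ∧ ∃ y, y ∉ S ∧ ends e = s(x, y)) mem_boundary.symm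

end Decidable

/-! ## The events of the Kozma–Nitzan family -/

section Events

variable {V : Type*} {E : Type*}

/-- `{v ↔ A}`: the open cluster of `v` meets the vertex set `A`. -/
def hitEvent (ends : E → Sym2 V) (v : V) (A : Finset V) : Set (Config E) :=
  {ω | ∃ a ∈ A, Conn ends ω v a}

/-- Membership in `hitEvent`. -/
@[simp] lemma mem_hitEvent {ends : E → Sym2 V} {v : V} {A : Finset V} {ω : Config E} :
    ω ∈ hitEvent ends v A ↔ ∃ a ∈ A, Conn ends ω v a := Iff.rfl

/-- `{v ↔ A}` is the crossing event from `{v}` to `A`. -/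
lemma hitEvent_eq_crossEvent (ends : E → Sym2 V) (v : V) (A : Finset V) :
    hitEvent ends v A = crossEvent ends {v} ↑A := by
  ext ω
  simp [crossEvent]

/-- `{v ↔ A}` is increasing. -/
lemma isUpperSet_hitEvent (ends : E → Sym2 V) (v : V) (A : Finset V) :
    IsUpperSet (hitEvent ends v A) := by
  rintro ω ω' h ⟨a, ha, hc⟩
  exact ⟨a, ha, conn_mono h hc⟩

/-- `{v ↔ a} ⊆ {v ↔ A}` for `a ∈ A`. -/
lemma connEvent_subset_hitEvent (ends : E → Sym2 V) (v : V) {A : Finset V} {a : V} (ha : a ∈ A) :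
    connEvent ends v a ⊆ hitEvent ends v A :=
  fun _ h => ⟨a, ha, h⟩

/-- `{v ↔ A}` for `v ∈ A` is the sure event. -/
lemma hitEvent_of_mem (ends : E → Sym2 V) {v : V} {A : Finset V} (hv : v ∈ A) :
    hitEvent ends v A = Set.univ :=
  Set.eq_univ_of_forall fun ω => ⟨v, hv, conn_refl ends ω v⟩

/-- `{C(v) ∩ A = S}` (for `S ⊆ A`): the hit set of the cluster of `v` in `A` is exactly `S`;
in general it is `{C(v) ∩ A = S ∩ A}`. -/
def hitSetEvent (ends : E → Sym2 V) (v : V) (A S : Finset V) : Set (Config E) :=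
  {ω | ∀ a ∈ A, (Conn ends ω v a ↔ a ∈ S)}

/-- Membership in `hitSetEvent`. -/
@[simp] lemma mem_hitSetEvent {ends : E → Sym2 V} {v : V} {A S : Finset V} {ω : Config E} :
    ω ∈ hitSetEvent ends v A S ↔ ∀ a ∈ A, (Conn ends ω v a ↔ a ∈ S) := Iff.rfl

/-- `{C(x) ∈ 𝓔}`: the open cluster of `x` belongs to the family `𝓔` of vertex sets. -/
def clusterInEvent (ends : E → Sym2 V) (x : V) (𝓔 : Set (Set V)) : Set (Config E) :=
  {ω | cluster ends ω x ∈ 𝓔}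

/-- Membership in `clusterInEvent`. -/
@[simp] lemma mem_clusterInEvent {ends : E → Sym2 V} {x : V} {𝓔 : Set (Set V)} {ω : Config E} :
    ω ∈ clusterInEvent ends x 𝓔 ↔ cluster ends ω x ∈ 𝓔 := Iff.rfl

/-- For an up-set `𝓔` of vertex sets, `{C(x) ∈ 𝓔}` is an increasing event. -/
lemma isUpperSet_clusterInEvent (ends : E → Sym2 V) (x : V) {𝓔 : Set (Set V)}
    (h𝓔 : IsUpperSet 𝓔) : IsUpperSet (clusterInEvent ends x 𝓔) :=
  fun _ _ h hω => h𝓔 (cluster_mono h x) hω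

/-- Connected vertices have the same cluster. -/
lemma cluster_eq_of_conn {ends : E → Sym2 V} {ω : Config E} {x y : V} (h : Conn ends ω x y) :
    cluster ends ω x = cluster ends ω y := by
  ext u
  exact ⟨fun hu => conn_trans (conn_symm h) hu, fun hu => conn_trans h hu⟩

/-- `{C(x) = S}` for `S` a vertex set is `{C(x) ∈ {S}}`. -/
lemma clusterEvent_eq_clusterInEvent (ends : E → Sym2 V) (x : V) (S : Set V) :
    clusterEvent ends x S = clusterInEvent ends x {S} := by
  ext ω
  simp

/-- The cluster property `1{C(x) ∈ 𝓔}` of a family `𝓔` of vertex sets (as a function of the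
vertex `x` and the configuration). -/
noncomputable def clusterIndicator {R : Type*} [Zero R] [One R] (ends : E → Sym2 V)
    (𝓔 : Set (Set V)) : V → Config E → R :=
  fun x ω => (clusterInEvent ends x 𝓔).indicator 1 ω

/-- The cluster property `F(C(x))` of a set function `F : Set V → R` (the lead's form of the
monotone cluster properties: `F` monotone under `⊆`). -/
def clusterFun {R : Type*} (ends : E → Sym2 V) (F : Set V → R) : V → Config E → R :=
  fun x ω => F (cluster ends ω x)

/-- A *monotone cluster property* (KN24 §5.1): `f v ω` is increasing in the cluster `C_ω(v)`
(hence depends only on it), and is constant along open edges. -/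
structure IsMonotoneClusterProperty {R : Type*} [LE R] (ends : E → Sym2 V)
    (f : V → Config E → R) : Prop where
  /-- `C_ω(v) ⊆ C_ξ(v)` implies `f v ω ≤ f v ξ`. -/
  mono : ∀ (v : V) (ω ξ : Config E), cluster ends ω v ⊆ cluster ends ξ v → f v ω ≤ f v ξ
  /-- `f` takes the same value at the two endpoints of an open edge. -/
  eq_of_openAdj : ∀ (v w : V) (ω : Config E), OpenAdj ends ω v w → f v ω = f w ω

/-- The cluster property `1{|C(x)| ≥ k}` (KN24 Theorem 9 / row R7). -/
noncomputable def clusterCardGE {R : Type*} [Zero R] [One R] (ends : E → Sym2 V) (k : ℕ) :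
    V → Config E → R :=
  fun x ω => if k ≤ clusterCard ends ω x then 1 else 0

/-- The cluster property `|C(x)|` (KN24 Theorem 10 / row R7). -/
noncomputable def clusterCardFun {R : Type*} [NatCast R] (ends : E → Sym2 V) :
    V → Config E → R :=
  fun x ω => (clusterCard ends ω x : R)

/-- The cluster property `1{x ↔ b}` (recovers Conjecture 2 from Conjecture 4). -/
noncomputable def connIndicator {R : Type*} [Zero R] [One R] (ends : E → Sym2 V) (b : V) :
    V → Config E → R :=
  fun x ω => (connEvent ends x b).indicator 1 ω

/-- `F ∘ C` takes the same value at connected vertices. -/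
lemma clusterFun_eq_of_conn {R : Type*} (ends : E → Sym2 V) (F : Set V → R) {x y : V}
    {ω : Config E} (h : Conn ends ω x y) : clusterFun ends F x ω = clusterFun ends F y ω := by
  simp only [clusterFun, cluster_eq_of_conn h]

variable [Fintype V] [DecidableEq V]

/-- `{u ↔ w in G ∖ W}`: connection after closing every edge touching the vertex set `W`
(the graph left after the explored cluster `W` is removed). -/
def connDelEvent (ends : E → Sym2 V) (W : Finset V) (u w : V) : Set (Config E) :=
  {ω | Conn ends (restrict (touches ends ↑W)ᶜ ω) u w}

/-- Membership in `connDelEvent`. -/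
@[simp] lemma mem_connDelEvent {ends : E → Sym2 V} {W : Finset V} {u w : V} {ω : Config E} :
    ω ∈ connDelEvent ends W u w ↔ Conn ends (restrict (touches ends ↑W)ᶜ ω) u w := Iff.rfl

/-- `{u ↔ w in G ∖ W} ⊆ {u ↔ w}`. -/
lemma connDelEvent_subset_connEvent (ends : E → Sym2 V) (W : Finset V) (u w : V) :
    connDelEvent ends W u w ⊆ connEvent ends u w :=
  fun _ h => conn_mono (restrict_le _ _) h

/-- `{u ↔ w in G ∖ W}` is determined by the edges not touching `W`. -/
lemma dependsOn_connDelEvent (ends : E → Sym2 V) (W : Finset V) (u w : V) :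
    DependsOn (· ∈ connDelEvent ends W u w) (touches ends ↑W)ᶜ :=
  dependsOn_restrict (touches ends ↑W)ᶜ fun ω' => Conn ends ω' u w

/-- In `G ∖ W` nothing outside `W` is connected to a vertex of `W`. -/
lemma not_conn_restrict_of_mem {ends : E → Sym2 V} {W : Finset V} {ω : Config E} {u w : V}
    (hu : u ∉ W) (hw : w ∈ W) : ¬ Conn ends (restrict (touches ends ↑W)ᶜ ω) u w := by
  intro h
  have key : w ∈ {x | x ∉ W} := by
    refine mem_of_conn_of_closed (ends := ends) (ω := restrict (touches ends ↑W)ᶜ ω) ?_ hu h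
    intro x hx y hxy
    obtain ⟨_, e, he, hends⟩ := openGraph_adj.1 hxy
    have he' : e ∉ touches ends ↑W := (restrict_eq_true_iff.1 he).2
    exact (not_mem_of_not_mem_touches hends he').2
  exact key hw

/-- `{u ↔ w in G ∖ W}` is empty when `w ∈ W` and `u ∉ W`. -/
lemma connDelEvent_eq_empty (ends : E → Sym2 V) {W : Finset V} {u w : V} (hu : u ∉ W)
    (hw : w ∈ W) : connDelEvent ends W u w = ∅ :=
  Set.eq_empty_of_forall_notMem fun _ h => not_conn_restrict_of_mem hu hw h

end Events

/-! ## Two targets: the hit sets of `A = {a₁, a₂}` -/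

section TwoTargets

variable {V : Type*} {E : Type*}

/-- On `{v ↔ a₁}`, `v ↔ a₂` is the same as `a₁ ↔ a₂`. -/
lemma connEvent_inter_connEvent_eq (ends : E → Sym2 V) (v a₁ a₂ : V) :
    connEvent ends v a₁ ∩ connEvent ends v a₂ = connEvent ends v a₁ ∩ connEvent ends a₁ a₂ := by
  ext ω
  simp only [Set.mem_inter_iff, mem_connEvent]
  exact ⟨fun ⟨h1, h2⟩ => ⟨h1, conn_trans (conn_symm h1) h2⟩,
    fun ⟨h1, h2⟩ => ⟨h1, conn_trans h1 h2⟩⟩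

/-- On `{v ↔ a₁}`, `v ↮ a₂` is the same as `a₁ ↮ a₂`. -/
lemma connEvent_inter_compl_connEvent_eq (ends : E → Sym2 V) (v a₁ a₂ : V) :
    connEvent ends v a₁ ∩ (connEvent ends v a₂)ᶜ =
      connEvent ends v a₁ ∩ (connEvent ends a₁ a₂)ᶜ := by
  ext ω
  simp only [Set.mem_inter_iff, Set.mem_compl_iff, mem_connEvent]
  exact ⟨fun ⟨h1, h2⟩ => ⟨h1, fun h => h2 (conn_trans h1 h)⟩,
    fun ⟨h1, h2⟩ => ⟨h1, fun h => h2 (conn_trans (conn_symm h1) h)⟩⟩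

/-- `{a ↔ b} = {b ↔ a}`. -/
lemma connEvent_comm (ends : E → Sym2 V) (a b : V) : connEvent ends a b = connEvent ends b a := by
  ext ω
  exact ⟨conn_symm, conn_symm⟩

variable [DecidableEq V]

/-- `{C(v) ∩ {a₁, a₂} = {a₁}} = {v ↔ a₁, v ↮ a₂}` for `a₁ ≠ a₂`. -/
lemma hitSetEvent_pair_left (ends : E → Sym2 V) {a₁ a₂ : V} (h : a₁ ≠ a₂) (v : V) :
    hitSetEvent ends v {a₁, a₂} {a₁} = connEvent ends v a₁ ∩ (connEvent ends v a₂)ᶜ := by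
  ext ω
  simp only [mem_hitSetEvent, Finset.mem_insert, Finset.mem_singleton, Set.mem_inter_iff,
    Set.mem_compl_iff, mem_connEvent]
  constructor
  · intro H
    exact ⟨(H a₁ (Or.inl rfl)).2 rfl, fun hc => h ((H a₂ (Or.inr rfl)).1 hc).symm⟩
  · rintro ⟨h1, h2⟩ a ha
    rcases ha with rfl | rfl
    · exact ⟨fun _ => rfl, fun _ => h1⟩
    · exact ⟨fun hc => (h2 hc).elim, fun heq => (h heq.symm).elim⟩

/-- `{C(v) ∩ {a₁, a₂} = {a₂}} = {v ↔ a₂, v ↮ a₁}` for `a₁ ≠ a₂`. -/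
lemma hitSetEvent_pair_right (ends : E → Sym2 V) {a₁ a₂ : V} (h : a₁ ≠ a₂) (v : V) :
    hitSetEvent ends v {a₁, a₂} {a₂} = connEvent ends v a₂ ∩ (connEvent ends v a₁)ᶜ := by
  rw [Finset.pair_comm]
  exact hitSetEvent_pair_left ends h.symm v

/-- `{C(v) ∩ {a₁, a₂} = {a₁, a₂}} = {v ↔ a₁} ∩ {v ↔ a₂}`. -/
lemma hitSetEvent_pair_both (ends : E → Sym2 V) (a₁ a₂ v : V) :
    hitSetEvent ends v {a₁, a₂} {a₁, a₂} = connEvent ends v a₁ ∩ connEvent ends v a₂ := by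
  ext ω
  simp only [mem_hitSetEvent, Finset.mem_insert, Finset.mem_singleton, Set.mem_inter_iff,
    mem_connEvent]
  constructor
  · intro H
    exact ⟨(H a₁ (Or.inl rfl)).2 (Or.inl rfl), (H a₂ (Or.inr rfl)).2 (Or.inr rfl)⟩
  · rintro ⟨h1, h2⟩ a ha
    exact ⟨fun _ => ha, fun _ => by rcases ha with rfl | rfl <;> assumption⟩

/-- `{C(v) ∩ {a₁, a₂} = ∅} = {v ↮ a₁} ∩ {v ↮ a₂}`. -/
lemma hitSetEvent_pair_empty (ends : E → Sym2 V) (a₁ a₂ v : V) :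
    hitSetEvent ends v {a₁, a₂} ∅ = (connEvent ends v a₁)ᶜ ∩ (connEvent ends v a₂)ᶜ := by
  ext ω
  simp only [mem_hitSetEvent, Finset.mem_insert, Finset.mem_singleton, Finset.notMem_empty,
    iff_false, Set.mem_inter_iff, Set.mem_compl_iff, mem_connEvent]
  constructor
  · intro H
    exact ⟨H a₁ (Or.inl rfl), H a₂ (Or.inr rfl)⟩
  · rintro ⟨h1, h2⟩ a ha
    rcases ha with rfl | rfl <;> assumption

end TwoTargets

/-! ## Probabilistic objects: the Green matrix, the first-hit law, the exploration functional -/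

section Objects

variable {V : Type*} {E : Type*} [Fintype E] [DecidableEq E] {R : Type*} [CommRing R]

/-- KN24's *Green matrix* `M_{a,a'} = P(v ↔ A, a ↔ a')` (§5.2). -/
noncomputable def greenMatrix (p : E → R) (ends : E → Sym2 V) (v : V) (A : Finset V) (a a' : V) : R :=
  prob p (hitEvent ends v A ∩ connEvent ends a a')

/-- The first-hit singleton weight `h_{{a}} = P(C(v) ∩ A = {a})`. -/
noncomputable def firstHitWeight (p : E → R) (ends : E → Sym2 V) (v : V) (A : Finset V) (a : V) : R :=
  prob p (hitSetEvent ends v A {a})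

/-- `E(f(x) · 1{v ↔ A})`, the cluster functional restricted to the hitting event. -/
noncomputable def hitExpect (p : E → R) (ends : E → Sym2 V) (A : Finset V) (v : V)
    (f : V → Config E → R) (x : V) : R :=
  expect p fun ω => f x ω * (hitEvent ends v A).indicator 1 ω

/-- The *Theorem 11 coefficients* (KN24 §5.2): `c` solves
`Σ_{a ∈ A} c_a · M_{a,a'} = P(v ↔ a')` for every `a' ∈ A`. -/
def IsT11Coeff (p : E → R) (ends : E → Sym2 V) (v : V) (A : Finset V) (c : V → R) : Prop :=
  ∀ a' ∈ A, ∑ a ∈ A, c a * greenMatrix p ends v A a a' = prob p (connEvent ends v a')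

/-- At `A = {a₁, a₂}` the first-hit weight of `a₁` is `h₁ = P(v ↔ a₁, a₁ ↮ a₂)` (the `h_j` of
`R6Core`). -/
lemma firstHitWeight_pair_left [DecidableEq V] (p : E → R) (ends : E → Sym2 V) {a₁ a₂ : V}
    (h : a₁ ≠ a₂) (v : V) :
    firstHitWeight p ends v {a₁, a₂} a₁ =
      prob p (connEvent ends v a₁ ∩ (connEvent ends a₁ a₂)ᶜ) := by
  unfold firstHitWeight
  rw [hitSetEvent_pair_left ends h v, connEvent_inter_compl_connEvent_eq]

/-- At `A = {a₁, a₂}` the first-hit weight of `a₂` is `h₂ = P(v ↔ a₂, a₁ ↮ a₂)`. -/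
lemma firstHitWeight_pair_right [DecidableEq V] (p : E → R) (ends : E → Sym2 V) {a₁ a₂ : V}
    (h : a₁ ≠ a₂) (v : V) :
    firstHitWeight p ends v {a₁, a₂} a₂ =
      prob p (connEvent ends v a₂ ∩ (connEvent ends a₁ a₂)ᶜ) := by
  unfold firstHitWeight
  rw [hitSetEvent_pair_right ends h v, connEvent_inter_compl_connEvent_eq,
    connEvent_comm ends a₂ a₁]

variable [Fintype V] [DecidableEq V] [LinearOrder R]

/-- The exploration functional `Γ(G, A, v, b)` of KN24 §3.2:
`min_{a ∈ A} P(a ↔ b) − Σ_{W ∩ A = ∅} P(C(v) = W) · min_{a ∈ A} P_{G ∖ W}(a ↔ b)`.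
(For `b ∈ W` the inner minimum is `0`: `b` is isolated in `G ∖ W` and `a ∉ W`.) -/
noncomputable def explorationFunctional (p : E → R) (ends : E → Sym2 V) (A : Finset V) (hA : A.Nonempty)
    (v b : V) : R :=
  A.inf' hA (fun a => prob p (connEvent ends a b)) -
    ∑ W ∈ (Finset.univ : Finset (Finset V)).filter (fun W => Disjoint W A),
      prob p (clusterEvent ends v ↑W) * A.inf' hA (fun a => prob p (connDelEvent ends W a b))

omit [LinearOrder R] in
/-- **Domain Markov identity in the `G ∖ W` vocabulary**: for `a ∉ W`,
`P(C(v) = W, a ↔ b) = P(C(v) = W) · P_{G ∖ W}(a ↔ b)` (the sublaw-free form of the terms of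
`explorationFunctional`; `Exploration.lean`'s `prob_clusterEvent_inter_connEvent`). -/
lemma prob_clusterEvent_inter_connEvent_eq_mul_connDel (p : E → R) (ends : E → Sym2 V) (v : V)
    (W : Finset V) {a b : V} (ha : a ∉ W) :
    prob p (clusterEvent ends v ↑W ∩ connEvent ends a b) =
      prob p (clusterEvent ends v ↑W) * prob p (connDelEvent ends W a b) :=
  prob_clusterEvent_inter_connEvent p ends v ↑W (by simpa using ha)

/-- The inner minimum of `explorationFunctional` vanishes on the clusters `W ∋ b`
(`W ∩ A = ∅`): KN24's convention `P_{G ∖ W}(a ↔ b) = 0` for `b ∈ W` is automatic. -/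
lemma inf'_prob_connDelEvent_eq_zero (p : E → R) (ends : E → Sym2 V) {A W : Finset V}
    (hA : A.Nonempty) (hW : Disjoint W A) {b : V} (hb : b ∈ W) :
    A.inf' hA (fun a => prob p (connDelEvent ends W a b)) = 0 :=
  Finset.inf'_eq_of_forall hA _ fun a ha => by
    rw [connDelEvent_eq_empty ends (Finset.disjoint_right.1 hW ha) hb, prob_empty]

end Objects

end Summit.Ventures.PercRepro2
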